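import Summits.NavierStokesRegularity.NavierStokesRegularity.Theorems.ExtremiserTransienceTwoThirdsCellPiece
import Summits.NavierStokesRegularity.NavierStokesRegularity.Theorems.ExtremiserTransienceTwoThirdsPieceL2Op
import Summits.NavierStokesRegularity.NavierStokesRegularity.Theorems.ExtremiserTransienceTwoThirdsPieceField
import Summits.NavierStokesRegularity.NavierStokesRegularity.Theorems.ExtremiserTransienceTwoThirdsCutoffPackage
import HarnessLib

/-!
# Route `ExtremiserTransience`, crux `NearExtremalTransiencePerFlow` (stmt-NavierStokesRegularity-26567),
# LINE g10-1 «two_thirds» (ns-idea-10), stub S1a′ — BRICK 2, lemma P4b: THE CELL PIECE PACKAGE `cell_piece`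

`--supports stmt-NavierStokesRegularity-26567` (helper; prover seat ns-net-p2 g13).  Normalised units (`‖w‖ ≤ 1`, `‖Dw‖ ≤ A₁`, linear growth `A_E`).
`cell_piece`: ONE constant `Cc = Cc(A₁, A_E)` such that for every centre `c` and scale `ρ ≥ 2` the cell `B(c, ρ⁸)` carries an admissible piece
`φ` (`C^∞_c`, divergence free, supported in `B(c, 3ρ⁸/2)`) and a weight `χ ∈ [0,1]` (`= 1` on the cell, `= 0` off `B(c, ρ⁸+ρ⁷)`, continuous,
supported in `B(c,3ρ⁸/2)`) with: `‖φ − χw‖ ≤ Cc/ρ²`, `‖Dφ − χDw‖ ≤ Cc/ρ²` (both `= 0` off `tsupport χ`); the offsets `curl φ − χω`,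
`D(curl φ) − χDω` vanish off the layer `L = B(c,ρ⁸+ρ⁷) ∖ B(c,ρ⁸)`, are square integrable, and
`∫‖curl φ − χω‖² ≤ Cc/ρ²`, `∫‖D(curl φ) − χDω‖² ≤ Cc(Z_{B(c,2ρ⁸)} + Z_{B(c,4ρ⁸)} + ∫_{B(c,2ρ⁸)}‖Dw‖² + 1)/ρ²`.
(`φ = curl(χ·K∗(ζw))`; everything from `…TwoThirdsCellPiece`, `…PieceField`, `…PieceGauge`, `…CutoffPackage`.)  These are exactly the
hypotheses of `piece_excess` (p732734) and of the remainder piece.  HONEST FRAMING: nothing about Navier–Stokes is proved; no summit is proved by a line. [folklore]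
-/

noncomputable section

open scoped Topology InnerProductSpace RealInnerProductSpace ENNReal NNReal ContDiff
open MeasureTheory Filter Set Metric
open Literature.Analysis.FluidPDE
open Summit.NavierStokesRegularity.NavierStokesRegularity.Theorems.DepletionLadder.KStar.HalfSpace
open Summit.NavierStokesRegularity.NavierStokesRegularity.Theorems.NearExtremalTransiencePerFlow.LocalMaximiser

namespace Summit.NavierStokesRegularity.NavierStokesRegularity.Theorems.NearExtremalTransiencePerFlow.TwoThirds

-- the summit's namespace repeats the problem name by convention (D-0017)
set_option linter.dupNamespace false

section Package

variable {w ψ G : E3 → E3} {χ : E3 → ℝ} {c : E3} {R ℓ : ℝ} {T : Set E3}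

/-- The two offsets of an abstract piece are square integrable (continuous, supported in the closed layer). [folklore] -/
theorem piece_offsets_integrable (hw : ContDiff ℝ (⊤ : ℕ∞) w) (hψ : ContDiff ℝ (⊤ : ℕ∞) ψ) (hG : ContDiff ℝ (⊤ : ℕ∞) G)
    (hχ : ContDiff ℝ (⊤ : ℕ∞) χ) (hcurl : ∀ x, curl ψ x = w x - G x)
    (hT : IsOpen T) (hχT : tsupport χ ⊆ T) (hG0 : ∀ x ∈ T, curl G x = 0)
    (hone : ∀ x ∈ ball c R, χ x = 1) (hzero : ∀ x, R + ℓ ≤ ‖x - c‖ → χ =ᶠ[𝓝 x] fun _ => (0 : ℝ)) :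
    Integrable (fun x => ‖curl (curl fun y => χ y • ψ y) x - χ x • curl w x‖ ^ 2) ∧
      Integrable (fun x => ‖fderiv ℝ (curl (curl fun y => χ y • ψ y)) x - χ x • fderiv ℝ (curl w) x‖ ^ 2) := by
  have hF : ContDiff ℝ (⊤ : ℕ∞) (curl (curl fun y => χ y • ψ y)) :=
    contDiff_curl (n := ⊤) (contDiff_curl (n := ⊤) (hχ.smul hψ))
  have hω : ContDiff ℝ (⊤ : ℕ∞) (curl w) := contDiff_curl (n := ⊤) hw
  have hc1 : Continuous fun x => ‖curl (curl fun y => χ y • ψ y) x - χ x • curl w x‖ ^ 2 :=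
    ((hF.continuous.sub (hχ.continuous.smul hω.continuous)).norm).pow 2
  have hc2 : Continuous fun x => ‖fderiv ℝ (curl (curl fun y => χ y • ψ y)) x - χ x • fderiv ℝ (curl w) x‖ ^ 2 :=
    (((hF.continuous_fderiv (by simp)).sub (hχ.continuous.smul (hω.continuous_fderiv (by simp)))).norm).pow 2
  have hK : IsCompact (closedBall c (R + ℓ)) := isCompact_closedBall c (R + ℓ)
  have hout : ∀ x, x ∉ closedBall c (R + ℓ) → x ∉ ball c (R + ℓ) \ ball c R := fun x hx h => hx (ball_subset_closedBall h.1)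
  refine ⟨hc1.integrable_of_hasCompactSupport (HasCompactSupport.intro hK fun x hx => ?_),
    hc2.integrable_of_hasCompactSupport (HasCompactSupport.intro hK fun x hx => ?_)⟩
  · rw [curl_piece_sub_eq_zero_off_layer hw hψ hG hχ hcurl hT hχT hG0 hone hzero (hout x hx), norm_zero, zero_pow two_ne_zero]
  · rw [fderiv_curl_piece_sub_eq_zero_off_layer hw hψ hG hχ hcurl hT hχT hG0 hone hzero (hout x hx), norm_zero, zero_pow two_ne_zero]

end Package

/-- **Core of the cell package**: all sizes of the piece `curl(χψ)` for an abstract gauge `ψ` with the concrete gauge/cutoff sizes at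
scale `ρ` (the constants `K 1, K 2, K 3` of `cutoff_package` and `C` of `pieceGauge_sizes` enter through the four blocks `B₁…B₄`). [folklore] -/
theorem cell_piece_core {w ψ : E3 → E3} {χ : E3 → ℝ} {c : E3} {ρ A₁ A_E C : ℝ} {K : ℕ → ℝ}
    (hA₁ : 0 ≤ A₁) (hAE : 0 ≤ A_E) (hC0 : 0 ≤ C) (hK0 : ∀ n, 0 ≤ K n) (hρ : 2 ≤ ρ)
    (hw : ContDiff ℝ (⊤ : ℕ∞) w) (hw1 : ∀ x, ‖w x‖ ≤ 1) (hgr : HasLinearGrowth A_E w)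
    (hχs : ContDiff ℝ (⊤ : ℕ∞) χ) (hχ01 : ∀ x, 0 ≤ χ x ∧ χ x ≤ 1) (hone : ∀ x ∈ ball c (ρ ^ 8), χ x = 1)
    (hzero : ∀ x, ρ ^ 8 + ρ ^ 7 ≤ ‖x - c‖ → χ =ᶠ[𝓝 x] fun _ => (0 : ℝ)) (hχsupp : tsupport χ ⊆ ball c (3 / 2 * ρ ^ 8))
    (hD1 : ∀ x, ‖fderiv ℝ χ x‖ ≤ K 1 / ρ ^ 7) (hD2 : ∀ x, ‖iteratedFDeriv ℝ 2 χ x‖ ≤ 2 * K 2 / (ρ ^ 7) ^ 2)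
    (hD3 : ∀ x ∈ ball c (ρ ^ 8 + ρ ^ 7) \ ball c (ρ ^ 8), ‖iteratedFDeriv ℝ 3 χ x‖ ≤ 6 * K 3 / (ρ ^ 7) ^ 3)
    (hψs : ContDiff ℝ (⊤ : ℕ∞) ψ) (hGs : ContDiff ℝ (⊤ : ℕ∞) fun x => w x - curl ψ x)
    (hG0 : ∀ x ∈ ball c (2 * ρ ^ 8), curl (fun x => w x - curl ψ x) x = 0)
    (hGle : ∀ x ∈ ball c (3 / 2 * ρ ^ 8), ‖w x - curl ψ x‖ ≤ C * (A_E + 5) / ρ ^ 8)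
    (hDGle : ∀ x ∈ ball c (3 / 2 * ρ ^ 8), ‖fderiv ℝ (fun x => w x - curl ψ x) x‖ ≤ C * (A_E + 5) / ρ ^ 16)
    (hψle : ∀ x ∈ ball c (2 * ρ ^ 8), ‖ψ x‖ ≤ C * (A_E + 5) * ρ) (hDψle : ∀ x, ‖fderiv ℝ ψ x‖ ≤ C * (A₁ + 1) * ρ ^ 4)
    (iDψ : Integrable fun x => ‖fderiv ℝ ψ x‖ ^ 2) (hDψ : ∫ x, ‖fderiv ℝ ψ x‖ ^ 2 ≤ C * A_E * ρ ^ 8)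
    (iD2ψ : Integrable fun x => ‖iteratedFDeriv ℝ 2 ψ x‖ ^ 2)
    (hD2ψ : ∫ x, ‖iteratedFDeriv ℝ 2 ψ x‖ ^ 2 ≤ C * (Zb w c (4 * ρ ^ 8) + A_E / ρ ^ 8)) :
    (∀ x, ‖curl (fun y => χ y • ψ y) x - χ x • w x‖ ≤ (C * (A_E + 5) + ‖curlCLM‖ * K 1 * (C * (A_E + 5))) / ρ ^ 2) ∧
    (∀ x, x ∉ tsupport χ → curl (fun y => χ y • ψ y) x - χ x • w x = 0) ∧
    (∀ x, ‖fderiv ℝ (curl fun y => χ y • ψ y) x - χ x • fderiv ℝ w x‖ ≤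
      (K 1 + C * (A_E + 5) + K 1 * (C * (A_E + 5)) + 2 * ‖curlCLM‖ * K 2 * (C * (A_E + 5)) + ‖curlCLM‖ * K 1 * (C * (A₁ + 1))) / ρ ^ 2) ∧
    (∀ x, x ∉ tsupport χ → fderiv ℝ (curl fun y => χ y • ψ y) x - χ x • fderiv ℝ w x = 0) ∧
    (∀ x, x ∉ ball c (ρ ^ 8 + ρ ^ 7) \ ball c (ρ ^ 8) → curl (curl fun y => χ y • ψ y) x - χ x • curl w x = 0) ∧
    Integrable (fun x => ‖curl (curl fun y => χ y • ψ y) x - χ x • curl w x‖ ^ 2) ∧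
    (∫ x, ‖curl (curl fun y => χ y • ψ y) x - χ x • curl w x‖ ^ 2 ≤
      3 * (34 * (‖curlCLM‖ * K 1 * (C * (A_E + 5)) + 2 * ‖curlCLM‖ * ‖curlCLM‖ * K 2 * (C * (A_E + 5))) ^ 2 +
        2 * ‖curlCLM‖ ^ 2 * K 1 ^ 2 * A_E + ‖curlCLM‖ ^ 4 * K 1 ^ 2 * C * A_E) / ρ ^ 2) ∧
    (∀ x, x ∉ ball c (ρ ^ 8 + ρ ^ 7) \ ball c (ρ ^ 8) →
      fderiv ℝ (curl (curl fun y => χ y • ψ y)) x - χ x • fderiv ℝ (curl w) x = 0) ∧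
    Integrable (fun x => ‖fderiv ℝ (curl (curl fun y => χ y • ψ y)) x - χ x • fderiv ℝ (curl w) x‖ ^ 2) ∧
    (∫ x, ‖fderiv ℝ (curl (curl fun y => χ y • ψ y)) x - χ x • fderiv ℝ (curl w) x‖ ^ 2 ≤
      6 * (34 * (2 * ‖curlCLM‖ * K 2 * (C * (A_E + 5)) + ‖curlCLM‖ * K 1 * (C * (A_E + 5)) +
        6 * ‖curlCLM‖ * ‖curlCLM‖ * K 3 * (C * (A_E + 5))) ^ 2 + K 1 ^ 2 + 8 * ‖curlCLM‖ ^ 2 * K 2 ^ 2 * A_E + ‖curlCLM‖ ^ 2 * K 1 ^ 2 +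
        16 * ‖curlCLM‖ ^ 4 * K 2 ^ 2 * C * A_E + ‖curlCLM‖ ^ 4 * K 1 ^ 2 * C * (1 + A_E)) *
        (Zb w c (2 * ρ ^ 8) + Zb w c (4 * ρ ^ 8) + (∫ x in ball c (2 * ρ ^ 8), ‖fderiv ℝ w x‖ ^ 2) + 1) / ρ ^ 2) := by
  have hρ0 : 0 < ρ := by linarith
  have ha0 : 0 ≤ C * (A_E + 5) := mul_nonneg hC0 (by linarith)
  have hb0 : 0 ≤ C * (A₁ + 1) := mul_nonneg hC0 (by linarith)
  have hK1 := hK0 1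
  have hK2 := hK0 2
  have hK3 := hK0 3
  have hχ1 : ∀ x, |χ x| ≤ 1 := fun x => abs_le.2 ⟨by linarith [(hχ01 x).1], (hχ01 x).2⟩
  have hcurl : ∀ x, curl ψ x = w x - (fun x => w x - curl ψ x) x := fun x => by simp only; abel
  have h32_2 : 3 / 2 * ρ ^ 8 ≤ 2 * ρ ^ 8 := by nlinarith [pow_pos hρ0 8]
  have hρ78 : ρ ^ 8 + ρ ^ 7 ≤ 3 / 2 * ρ ^ 8 := by
    have : 2 * ρ ^ 7 ≤ ρ ^ 8 := by rw [show ρ ^ 8 = ρ * ρ ^ 7 by ring]; exact mul_le_mul_of_nonneg_right hρ (by positivity)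
    linarith
  have hχT : tsupport χ ⊆ ball c (2 * ρ ^ 8) := hχsupp.trans (ball_subset_ball h32_2)
  have hLS : ∀ x ∈ ball c (ρ ^ 8 + ρ ^ 7) \ ball c (ρ ^ 8), x ∈ ball c (3 / 2 * ρ ^ 8) := fun x hx => ball_subset_ball hρ78 hx.1
  have hψle' : ∀ x ∈ ball c (3 / 2 * ρ ^ 8), ‖ψ x‖ ≤ C * (A_E + 5) * ρ := fun x hx => hψle x (ball_subset_ball h32_2 hx)
  obtain ⟨p1, p2, p3, p4⟩ := cell_piece_pointwise (a := C * (A_E + 5)) (b := C * (A₁ + 1)) (K₁ := K 1) (K₂ := K 2) hρ ha0 hb0 hK1 hK2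
    hw hw1 hψs hGs hχs hcurl hχ1 hχsupp hD1 hD2 hGle hDGle hψle' hDψle
  obtain ⟨hi1, hi2⟩ := piece_offsets_integrable hw hψs hGs hχs hcurl isOpen_ball hχT hG0 hone hzero
  have hk10 : 0 ≤ K 1 / ρ ^ 7 := by positivity
  have hk20 : 0 ≤ 2 * K 2 / (ρ ^ 7) ^ 2 := by positivity
  have hk30 : 0 ≤ 6 * K 3 / (ρ ^ 7) ^ 3 := by positivity
  have hgr2 : ∫ x in ball c (2 * ρ ^ 8), ‖w x‖ ^ 2 ≤ A_E * (2 * ρ ^ 8) := hgr c (2 * ρ ^ 8) (by positivity)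
  have he10 : ∀ x, x ∉ ball c (ρ ^ 8 + ρ ^ 7) \ ball c (ρ ^ 8) → curl (curl fun y => χ y • ψ y) x - χ x • curl w x = 0 :=
    fun x hx => curl_piece_sub_eq_zero_off_layer hw hψs hGs hχs hcurl isOpen_ball hχT hG0 hone hzero hx
  have he20 : ∀ x, x ∉ ball c (ρ ^ 8 + ρ ^ 7) \ ball c (ρ ^ 8) →
      fderiv ℝ (curl (curl fun y => χ y • ψ y)) x - χ x • fderiv ℝ (curl w) x = 0 :=
    fun x hx => fderiv_curl_piece_sub_eq_zero_off_layer hw hψs hGs hχs hcurl isOpen_ball hχT hG0 hone hzero hx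
  have hj₁ := cell_e1_L2 (e := fun x => curl (curl fun y => χ y • ψ y) x - χ x • curl w x) (a := C * (A_E + 5)) (K₁ := K 1) (K₂ := K 2) (A_E := A_E) (C := C) hρ ha0 hK1 hK2 hAE hC0 hw hgr2 iDψ hDψ
    he10 hi1 (fun x hx => norm_curl_piece_sub_le_of_sizes hw hψs hGs hχs hcurl isOpen_ball hχT hG0 hk10 hk20 hD1 hD2 hGle hψle' (hLS x hx))
  have hj₂ := cell_e2_L2_op (e := fun x => fderiv ℝ (curl (curl fun y => χ y • ψ y)) x - χ x • fderiv ℝ (curl w) x) (a := C * (A_E + 5)) (K₁ := K 1) (K₂ := K 2) (K₃ := K 3) (A_E := A_E) (C := C) hρ ha0 hK1 hK2 hK3 hAE hC0 hw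
    hgr2 iDψ hDψ iD2ψ hD2ψ he20 hi2
    (fun x hx => norm_fderiv_curl_piece_sub_le_of_sizes hw hψs hGs hχs hcurl isOpen_ball hχT hG0 hk10 hk20 hk30 hD1 hD2 hGle hDGle hψle'
      (hLS x hx) (hD3 x hx))
  exact ⟨p1, p2, p3, p4, he10, hi1, hj₁, he20, hi2, hj₂⟩

/-- **THE CELL PIECE PACKAGE** (see the module docstring). [folklore] -/
theorem cell_piece (A₁ A_E : ℝ) (hA₁ : 0 ≤ A₁) (hAE : 0 ≤ A_E) :
    ∃ Cc : ℝ, 0 ≤ Cc ∧ ∀ (w : E3 → E3) (c : E3) (ρ : ℝ),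
    ContDiff ℝ (⊤ : ℕ∞) w → VectorCalculus.IsDivFree w → (∀ x, ‖w x‖ ≤ 1) → (∀ x, ‖fderiv ℝ w x‖ ≤ A₁) →
    HasLinearGrowth A_E w → 2 ≤ ρ →
    ∃ (φ : E3 → E3) (χ : E3 → ℝ),
      ContDiff ℝ (⊤ : ℕ∞) φ ∧ HasCompactSupport φ ∧ VectorCalculus.IsDivFree φ ∧ tsupport φ ⊆ ball c (3 / 2 * ρ ^ 8) ∧
      Continuous χ ∧ (∀ x, 0 ≤ χ x ∧ χ x ≤ 1) ∧ (∀ x ∈ ball c (ρ ^ 8), χ x = 1) ∧ (∀ x, x ∉ ball c (ρ ^ 8 + ρ ^ 7) → χ x = 0) ∧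
      tsupport χ ⊆ ball c (3 / 2 * ρ ^ 8) ∧
      (∀ x, ‖φ x - χ x • w x‖ ≤ Cc / ρ ^ 2) ∧ (∀ x, x ∉ tsupport χ → φ x - χ x • w x = 0) ∧
      (∀ x, ‖fderiv ℝ φ x - χ x • fderiv ℝ w x‖ ≤ Cc / ρ ^ 2) ∧ (∀ x, x ∉ tsupport χ → fderiv ℝ φ x - χ x • fderiv ℝ w x = 0) ∧
      (∀ x, x ∉ ball c (ρ ^ 8 + ρ ^ 7) \ ball c (ρ ^ 8) → curl φ x - χ x • curl w x = 0) ∧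
      Integrable (fun x => ‖curl φ x - χ x • curl w x‖ ^ 2) ∧ (∫ x, ‖curl φ x - χ x • curl w x‖ ^ 2 ≤ Cc / ρ ^ 2) ∧
      (∀ x, x ∉ ball c (ρ ^ 8 + ρ ^ 7) \ ball c (ρ ^ 8) → fderiv ℝ (curl φ) x - χ x • fderiv ℝ (curl w) x = 0) ∧
      Integrable (fun x => ‖fderiv ℝ (curl φ) x - χ x • fderiv ℝ (curl w) x‖ ^ 2) ∧
      (∫ x, ‖fderiv ℝ (curl φ) x - χ x • fderiv ℝ (curl w) x‖ ^ 2 ≤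
        Cc * (Zb w c (2 * ρ ^ 8) + Zb w c (4 * ρ ^ 8) + (∫ x in ball c (2 * ρ ^ 8), ‖fderiv ℝ w x‖ ^ 2) + 1) / ρ ^ 2) := by
  obtain ⟨K, hK0, hcut⟩ := cutoff_package
  obtain ⟨C, hC0, hC⟩ := pieceGauge_sizes
  have ha0 : 0 ≤ C * (A_E + 5) := mul_nonneg hC0 (by linarith)
  have hb0 : 0 ≤ C * (A₁ + 1) := mul_nonneg hC0 (by linarith)
  have hK1 := hK0 1
  have hK2 := hK0 2
  have hK3 := hK0 3
  -- the four blocks of the constant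
  obtain ⟨B₁, hB₁⟩ : ∃ B₁ : ℝ, B₁ = C * (A_E + 5) + ‖curlCLM‖ * K 1 * (C * (A_E + 5)) := ⟨_, rfl⟩
  obtain ⟨B₂, hB₂⟩ : ∃ B₂ : ℝ, B₂ = K 1 + C * (A_E + 5) + K 1 * (C * (A_E + 5)) + 2 * ‖curlCLM‖ * K 2 * (C * (A_E + 5)) +
      ‖curlCLM‖ * K 1 * (C * (A₁ + 1)) := ⟨_, rfl⟩
  obtain ⟨B₃, hB₃⟩ : ∃ B₃ : ℝ, B₃ = 3 * (34 * (‖curlCLM‖ * K 1 * (C * (A_E + 5)) + 2 * ‖curlCLM‖ * ‖curlCLM‖ * K 2 * (C * (A_E + 5))) ^ 2 +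
      2 * ‖curlCLM‖ ^ 2 * K 1 ^ 2 * A_E + ‖curlCLM‖ ^ 4 * K 1 ^ 2 * C * A_E) := ⟨_, rfl⟩
  obtain ⟨B₄, hB₄⟩ : ∃ B₄ : ℝ, B₄ = 6 * (34 * (2 * ‖curlCLM‖ * K 2 * (C * (A_E + 5)) + ‖curlCLM‖ * K 1 * (C * (A_E + 5)) +
      6 * ‖curlCLM‖ * ‖curlCLM‖ * K 3 * (C * (A_E + 5))) ^ 2 + K 1 ^ 2 + 8 * ‖curlCLM‖ ^ 2 * K 2 ^ 2 * A_E + ‖curlCLM‖ ^ 2 * K 1 ^ 2 +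
      16 * ‖curlCLM‖ ^ 4 * K 2 ^ 2 * C * A_E + ‖curlCLM‖ ^ 4 * K 1 ^ 2 * C * (1 + A_E)) := ⟨_, rfl⟩
  have hB₁0 : 0 ≤ B₁ := by rw [hB₁]; positivity
  have hB₂0 : 0 ≤ B₂ := by rw [hB₂]; positivity
  have hB₃0 : 0 ≤ B₃ := by rw [hB₃]; positivity
  have hB₄0 : 0 ≤ B₄ := by rw [hB₄]; positivity
  refine ⟨B₁ + B₂ + B₃ + B₄, by positivity, ?_⟩
  intro w c ρ hw hdiv hw1 hDw hgr hρ
  have hρ0 : 0 < ρ := by linarith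
  have hρ2 : 0 < ρ ^ 2 := by positivity
  have hR0 : 0 < ρ ^ 8 := by positivity
  -- the cutoff
  obtain ⟨χ, hχs, hχc, hχ01, hone, hχout, hzero, hχsupp, -, hD1i, hD2i, -, -, hD3⟩ := hcut c ρ hρ
  have hind : ∀ x, (ball c (ρ ^ 8 + ρ ^ 7) \ ball c (ρ ^ 8)).indicator (fun _ => (1 : ℝ)) x ≤ 1 := fun x => by
    by_cases hx : x ∈ ball c (ρ ^ 8 + ρ ^ 7) \ ball c (ρ ^ 8)
    · rw [indicator_of_mem hx]
    · rw [indicator_of_notMem hx]; exact zero_le_one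
  have hD1 : ∀ x, ‖fderiv ℝ χ x‖ ≤ K 1 / ρ ^ 7 := fun x =>
    (hD1i x).trans ((mul_le_mul_of_nonneg_left (hind x) (by positivity)).trans_eq (mul_one _))
  have hD2 : ∀ x, ‖iteratedFDeriv ℝ 2 χ x‖ ≤ 2 * K 2 / (ρ ^ 7) ^ 2 := fun x =>
    (hD2i x).trans ((mul_le_mul_of_nonneg_left (hind x) (by positivity)).trans_eq (mul_one _))
  -- the gauge
  obtain ⟨hψs, hGs, hG0, hGle, hDGle, hψle, hDψle, iDψ, hDψ, iD2ψ, hD2ψ⟩ := hC w A₁ A_E c ρ hw hdiv hw1 hDw hA₁ hgr hAE hρ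
  -- the piece and its qualitative admissibility (before freezing the gauge)
  obtain ⟨hφs, hφc, hφsupp, hφdiv⟩ := pieceField_admissible hw hχs hχc (contDiff_ballCutoff c (ρ ^ 8)) (hasCompactSupport_ballCutoff hR0)
  generalize biotSavart (fun y => ballCutoff c (ρ ^ 8) y • w y) = ψ at *
  obtain ⟨p1, p2, p3, p4, he10, hi1, hj₁, he20, hi2, hj₂⟩ := cell_piece_core hA₁ hAE hC0 hK0 hρ hw hw1 hgr hχs hχ01 hone hzero hχsupp
    hD1 hD2 hD3 hψs hGs hG0 hGle hDGle hψle hDψle iDψ hDψ iD2ψ hD2ψ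
  -- constants against `Cc = B₁ + B₂ + B₃ + B₄`
  have hS0 : 0 ≤ Zb w c (2 * ρ ^ 8) + Zb w c (4 * ρ ^ 8) + (∫ x in ball c (2 * ρ ^ 8), ‖fderiv ℝ w x‖ ^ 2) + 1 := by
    have := Zb_nonneg w c (2 * ρ ^ 8)
    have := Zb_nonneg w c (4 * ρ ^ 8)
    have : 0 ≤ ∫ x in ball c (2 * ρ ^ 8), ‖fderiv ℝ w x‖ ^ 2 := setIntegral_nonneg measurableSet_ball fun x _ => sq_nonneg _
    linarith
  have q1 : (C * (A_E + 5) + ‖curlCLM‖ * K 1 * (C * (A_E + 5))) / ρ ^ 2 ≤ (B₁ + B₂ + B₃ + B₄) / ρ ^ 2 :=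
    div_le_div_of_nonneg_right (by rw [← hB₁]; linarith only [hB₂0, hB₃0, hB₄0]) hρ2.le
  have q2 : (K 1 + C * (A_E + 5) + K 1 * (C * (A_E + 5)) + 2 * ‖curlCLM‖ * K 2 * (C * (A_E + 5)) + ‖curlCLM‖ * K 1 * (C * (A₁ + 1))) / ρ ^ 2 ≤
      (B₁ + B₂ + B₃ + B₄) / ρ ^ 2 :=
    div_le_div_of_nonneg_right (by rw [← hB₂]; linarith only [hB₁0, hB₃0, hB₄0]) hρ2.le
  have q3 : 3 * (34 * (‖curlCLM‖ * K 1 * (C * (A_E + 5)) + 2 * ‖curlCLM‖ * ‖curlCLM‖ * K 2 * (C * (A_E + 5))) ^ 2 +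
      2 * ‖curlCLM‖ ^ 2 * K 1 ^ 2 * A_E + ‖curlCLM‖ ^ 4 * K 1 ^ 2 * C * A_E) / ρ ^ 2 ≤ (B₁ + B₂ + B₃ + B₄) / ρ ^ 2 :=
    div_le_div_of_nonneg_right (by rw [← hB₃]; linarith only [hB₁0, hB₂0, hB₄0]) hρ2.le
  have q4 : 6 * (34 * (2 * ‖curlCLM‖ * K 2 * (C * (A_E + 5)) + ‖curlCLM‖ * K 1 * (C * (A_E + 5)) +
      6 * ‖curlCLM‖ * ‖curlCLM‖ * K 3 * (C * (A_E + 5))) ^ 2 + K 1 ^ 2 + 8 * ‖curlCLM‖ ^ 2 * K 2 ^ 2 * A_E + ‖curlCLM‖ ^ 2 * K 1 ^ 2 +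
      16 * ‖curlCLM‖ ^ 4 * K 2 ^ 2 * C * A_E + ‖curlCLM‖ ^ 4 * K 1 ^ 2 * C * (1 + A_E)) *
      (Zb w c (2 * ρ ^ 8) + Zb w c (4 * ρ ^ 8) + (∫ x in ball c (2 * ρ ^ 8), ‖fderiv ℝ w x‖ ^ 2) + 1) / ρ ^ 2 ≤
      (B₁ + B₂ + B₃ + B₄) * (Zb w c (2 * ρ ^ 8) + Zb w c (4 * ρ ^ 8) + (∫ x in ball c (2 * ρ ^ 8), ‖fderiv ℝ w x‖ ^ 2) + 1) / ρ ^ 2 := by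
    rw [← hB₄]
    exact div_le_div_of_nonneg_right (mul_le_mul_of_nonneg_right (by linarith only [hB₁0, hB₂0, hB₃0]) hS0) hρ2.le
  exact ⟨curl (fun y => χ y • ψ y), χ, hφs, hφc, hφdiv, hφsupp.trans hχsupp, hχs.continuous, hχ01, hone, hχout, hχsupp,
    fun x => (p1 x).trans q1, p2, fun x => (p3 x).trans q2, p4, he10, hi1, hj₁.trans q3, he20, hi2, hj₂.trans q4⟩

end Summit.NavierStokesRegularity.NavierStokesRegularity.Theorems.NearExtremalTransiencePerFlow.TwoThirds

end
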